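import Summits.HodgeConjecture.HodgeConjecture.Theorems.NikulinTwinTransportSquareHodgeOfSqrtTwoRationalCore
import Summits.HodgeConjecture.HodgeConjecture.Theorems.NikulinTwinTransportTwinSimilitudeAlgebraicMarkings
import Mathlib.LinearAlgebra.TensorProduct.Pi
import Mathlib.LinearAlgebra.BilinearForm.TensorProduct
import Literature.AlgebraicGeometry.Motives.HodgeStructure

/-!
# Route AnchorTransport — `AnchorExistence` (stmt-HodgeConjecture-1077), line `Sketch`, CM floor:
# complexification in the marking picture

Linear algebra on the K3 lattice `Λ_ℚ = ℚ²²` (`K3Index → ℚ`, form `k3FormRat`) and its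
complexification `Λ_ℂ = ℂ²²` (`k3Form`), serving the CM floor of the K3-square sector of crux
`AnchorExistence`: the complexification `cxEnd τ` of a rational endomorphism `τ` of `Λ_ℚ`
(characterised by `cxEnd τ ∘ ι = ι ∘ τ` on `Λ_ℚ ⊂ Λ_ℂ`; a ring homomorphism, real, and isometric
when `τ` is), and, for a splitting `Λ_ℚ = N ⊕ T`, the identification
`ι_T : ℂ ⊗_ℚ T ↪ Λ_ℂ` of the abstract complexification of `T` (the carrier of the tree's
filtration-form Hodge structures, `Motives/HodgeStructure`) with the complex span of `T` inside
`Λ_ℂ`, together with its retraction `λ_T` (`λ_T ∘ ι_T = id`, `ι_T ∘ λ_T =` the complexified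
projection onto `T`), the compatibility of `ι_T` with complex conjugation and with the base change
of the restricted form. This is the bookkeeping behind "`T(S)_ℚ ⊂ H²(S, ℚ)` is a rational Hodge
structure" (Huybrechts, *Lectures on K3 Surfaces*, Ch. 3 §2.2 and Lemma 3.1) in the marking
picture of route NikulinTwinTransport.

## References

* [Huybrechts2016K3] D. Huybrechts, Lectures on K3 Surfaces, CUP 2016, Ch. 3 §2.2, Lemma 3.3.1.
* [VoisinHodgeI2002] C. Voisin, Hodge Theory and Complex Algebraic Geometry I, CUP 2002, §7.1.1.
-/

noncomputable section

set_option linter.dupNamespace false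

open scoped TensorProduct
open Literature.AlgebraicGeometry.Surfaces Literature.AlgebraicGeometry.Motives
open Summit.HodgeConjecture.HodgeConjecture.Theorems.NikulinTwinTransport

namespace Summit.HodgeConjecture.HodgeConjecture.Theorems.AnchorExistenceCMFloor

/-! ### Rational vectors of `Λ_ℂ` -/

/-- A rational vector of `Λ_ℂ` expanded in the standard basis: `ι v = Σⱼ vⱼ eⱼ`. [folklore] -/
theorem ratCastΛ_eq_sum (v : K3Index → ℚ) :
    (fun i => (v i : ℂ)) = ∑ j, (v j : ℂ) • (Pi.basisFun ℂ K3Index) j := by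
  conv_lhs => rw [← (Pi.basisFun ℂ K3Index).sum_repr (fun i => (v i : ℂ))]
  simp only [Pi.basisFun_repr]

/-- A vector of `Λ_ℚ` expanded in the standard basis: `v = Σⱼ vⱼ eⱼ`. [folklore] -/
theorem eq_sum_single (v : K3Index → ℚ) :
    v = ∑ j, v j • (Pi.single j (1 : ℚ) : K3Index → ℚ) := by
  conv_lhs => rw [← (Pi.basisFun ℚ K3Index).sum_repr v]
  simp only [Pi.basisFun_repr, Pi.basisFun_apply]

/-! ### Complexification of rational endomorphisms of `Λ_ℚ` -/

/-- **Complexification `τ_ℂ` of a `ℚ`-linear endomorphism `τ` of `Λ_ℚ`**: the `ℂ`-linear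
endomorphism of `Λ_ℂ` taking the (rational) standard basis vector `eⱼ` to `ι (τ eⱼ)`.
[cite: VoisinHodgeI2002, §7.1.1] -/
def cxEnd (τ : Module.End ℚ (K3Index → ℚ)) : Module.End ℂ (K3Index → ℂ) :=
  (Pi.basisFun ℂ K3Index).constr ℂ fun j => fun i => ((τ (Pi.single j 1)) i : ℂ)

/-- The complexification extends `τ`: `τ_ℂ (ι v) = ι (τ v)` for `v ∈ Λ_ℚ`. [folklore] -/
theorem cxEnd_ratCast (τ : Module.End ℚ (K3Index → ℚ)) (v : K3Index → ℚ) :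
    cxEnd τ (fun i => (v i : ℂ)) = fun i => (τ v i : ℂ) := by
  rw [ratCastΛ_eq_sum, map_sum]
  simp only [map_smul, cxEnd, Module.Basis.constr_basis]
  conv_rhs => rw [eq_sum_single v, map_sum, ratCastΛ_sum]
  refine Finset.sum_congr rfl fun j _ => ?_
  rw [map_smul, ratCastΛ_smul]

/-- The complexification is characterised by `τ_ℂ ∘ ι = ι ∘ τ` (rational vectors span `Λ_ℂ`).
[folklore] -/
theorem eq_cxEnd_of_forall {τ : Module.End ℚ (K3Index → ℚ)} {M : Module.End ℂ (K3Index → ℂ)}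
    (hM : ∀ v : K3Index → ℚ, M (fun i => (v i : ℂ)) = fun i => (τ v i : ℂ)) : M = cxEnd τ :=
  eq_of_forall_ratCast fun v => by rw [hM, cxEnd_ratCast]

/-- Complexification is a ring homomorphism `End_ℚ(Λ_ℚ) → End_ℂ(Λ_ℂ)`. [folklore] -/
def cxEndHom : Module.End ℚ (K3Index → ℚ) →+* Module.End ℂ (K3Index → ℂ) where
  toFun := cxEnd
  map_one' := (eq_cxEnd_of_forall (M := 1) fun v => rfl).symm
  map_mul' τ₁ τ₂ := (eq_cxEnd_of_forall fun v => by
    rw [Module.End.mul_apply, cxEnd_ratCast, cxEnd_ratCast, Module.End.mul_apply]).symm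
  map_zero' := (eq_cxEnd_of_forall (M := 0) fun v => by
    rw [LinearMap.zero_apply, LinearMap.zero_apply, ratCastΛ_zero]).symm
  map_add' τ₁ τ₂ := (eq_cxEnd_of_forall fun v => by
    rw [LinearMap.add_apply, cxEnd_ratCast, cxEnd_ratCast, LinearMap.add_apply, ratCastΛ_add]).symm

/-- `cxEndHom` is `cxEnd`. [folklore] -/
@[simp] theorem cxEndHom_apply (τ : Module.End ℚ (K3Index → ℚ)) : cxEndHom τ = cxEnd τ := rfl

/-- Complexification is compatible with rational scalars. [folklore] -/
theorem cxEnd_smul (q : ℚ) (τ : Module.End ℚ (K3Index → ℚ)) : cxEnd (q • τ) = (q : ℂ) • cxEnd τ :=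
  (eq_cxEnd_of_forall fun v => by
    rw [LinearMap.smul_apply, cxEnd_ratCast, LinearMap.smul_apply, ratCastΛ_smul]).symm

/-- Complexification of the identity. [folklore] -/
theorem cxEnd_one : cxEnd 1 = 1 := map_one cxEndHom

/-- Complexification of the identity, `LinearMap.id` form. [folklore] -/
theorem cxEnd_id : cxEnd LinearMap.id = LinearMap.id := map_one cxEndHom

/-- Complexification of a composite. [folklore] -/
theorem cxEnd_comp (τ₁ τ₂ : Module.End ℚ (K3Index → ℚ)) : cxEnd (τ₁ ∘ₗ τ₂) = cxEnd τ₁ ∘ₗ cxEnd τ₂ :=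
  map_mul cxEndHom τ₁ τ₂

/-- Complexification of a sum. [folklore] -/
theorem cxEnd_add (τ₁ τ₂ : Module.End ℚ (K3Index → ℚ)) : cxEnd (τ₁ + τ₂) = cxEnd τ₁ + cxEnd τ₂ :=
  map_add cxEndHom τ₁ τ₂

/-- Complexification of a difference. [folklore] -/
theorem cxEnd_sub (τ₁ τ₂ : Module.End ℚ (K3Index → ℚ)) : cxEnd (τ₁ - τ₂) = cxEnd τ₁ - cxEnd τ₂ :=
  map_sub cxEndHom τ₁ τ₂

/-- Complexification of a finite sum. [folklore] -/
theorem cxEnd_sum {ι : Type*} (s : Finset ι) (τ : ι → Module.End ℚ (K3Index → ℚ)) :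
    cxEnd (∑ i ∈ s, τ i) = ∑ i ∈ s, cxEnd (τ i) :=
  map_sum cxEndHom τ s

/-- A complexification is defined over `ℚ`: it maps `Λ` into `Λ_ℚ`. [folklore] -/
theorem cxEnd_intCast (τ : Module.End ℚ (K3Index → ℚ)) (v : K3Index → ℤ) :
    ∃ w : K3Index → ℚ, cxEnd τ (fun i => (v i : ℂ)) = fun i => (w i : ℂ) :=
  forall_intCast_of_complexification (cxEnd_ratCast τ) v

/-- **A complexification is real**: it commutes with complex conjugation of the coordinates.
[folklore] -/
theorem cxEnd_star (τ : Module.End ℚ (K3Index → ℚ)) (z : K3Index → ℂ) :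
    cxEnd τ (star z) = star (cxEnd τ z) :=
  ratEnd_star _ (cxEnd_intCast τ) z

/-- **The complexification of a rational isometry of `Λ_ℚ` is an isometry of `(Λ_ℂ, k3Form)`.**
[cite: Huybrechts2016K3, Ch. 3 §2.2] -/
theorem k3Form_cxEnd (τ : Module.End ℚ (K3Index → ℚ))
    (hτ : ∀ v w, k3FormRat (τ v) (τ w) = k3FormRat v w) (a b : K3Index → ℂ) :
    k3Form (cxEnd τ a) (cxEnd τ b) = k3Form a b := by
  have h : k3FormC.compl₁₂ (cxEnd τ) (cxEnd τ) = k3FormC := by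
    refine eq_of_forall_ratCast fun v => eq_of_forall_ratCast fun w => ?_
    rw [LinearMap.compl₁₂_apply, cxEnd_ratCast, cxEnd_ratCast, k3FormC_apply, k3FormC_apply,
      k3Form_ratCast, k3Form_ratCast, hτ]
  have h' := LinearMap.congr_fun₂ h a b
  rwa [LinearMap.compl₁₂_apply, k3FormC_apply, k3FormC_apply] at h'

/-- The image of a vector under a complexification lies in the complex span of the image of `τ`:
`τ_ℂ z ∈ ⟨ι (τ v) | v⟩_ℂ`. [folklore] -/
theorem cxEnd_mem_span (τ : Module.End ℚ (K3Index → ℚ)) (z : K3Index → ℂ) :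
    cxEnd τ z ∈ Submodule.span ℂ (Set.range fun v : K3Index → ℚ => fun i => (τ v i : ℂ)) := by
  have hz : z = ∑ j, z j • (Pi.basisFun ℂ K3Index) j := by
    conv_lhs => rw [← (Pi.basisFun ℂ K3Index).sum_repr z]
    simp only [Pi.basisFun_repr]
  rw [hz, map_sum]
  refine Submodule.sum_mem _ fun j _ => ?_
  rw [map_smul, basisFun_eq_ratCastΛ, cxEnd_ratCast]
  exact Submodule.smul_mem _ _ (Submodule.subset_span ⟨_, rfl⟩)

/-! ### The complexification `ℂ ⊗_ℚ T` of a subspace `T ≤ Λ_ℚ`, inside `Λ_ℂ` -/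

section Subspace

variable (T : Submodule ℚ (K3Index → ℚ))

/-- **`ι_T : ℂ ⊗_ℚ T → Λ_ℂ`**, `c ⊗ t ↦ c · ι(t)`: the abstract complexification of a rational
subspace `T ≤ Λ_ℚ` (the carrier of the tree's Hodge structures on `T`) realised inside `Λ_ℂ`.
[cite: VoisinHodgeI2002, §7.1.1] -/
def iota : ℂ ⊗[ℚ] T →ₗ[ℂ] (K3Index → ℂ) :=
  (TensorProduct.piScalarRight ℚ ℂ ℂ K3Index).toLinearMap ∘ₗ (T.subtype.baseChange ℂ)

/-- `ι_T (c ⊗ t) = c · ι(t)`. [folklore] -/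
theorem iota_tmul (c : ℂ) (t : T) :
    iota T (c ⊗ₜ[ℚ] t) = c • fun i => ((t : K3Index → ℚ) i : ℂ) := by
  simp only [iota, LinearMap.comp_apply, LinearMap.baseChange_tmul, LinearEquiv.coe_coe,
    TensorProduct.piScalarRight_apply, TensorProduct.piScalarRightHom_tmul, Submodule.subtype_apply]
  funext i
  simp only [Pi.smul_apply, smul_eq_mul, Rat.smul_def, mul_comm]

/-- `ι_T (1 ⊗ t) = ι(t)`: on `T ⊂ ℂ ⊗_ℚ T` the map `ι_T` is the inclusion `Λ_ℚ ⊂ Λ_ℂ`. [folklore] -/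
theorem iota_one_tmul (t : T) : iota T (1 ⊗ₜ[ℚ] t) = fun i => ((t : K3Index → ℚ) i : ℂ) := by
  rw [iota_tmul, one_smul]

/-- `ι_T` takes values in the complex span of `T`. [folklore] -/
theorem iota_mem_span (z : ℂ ⊗[ℚ] T) :
    iota T z ∈ Submodule.span ℂ (Set.range fun t : T => fun i => ((t : K3Index → ℚ) i : ℂ)) := by
  induction z using TensorProduct.induction_on with
  | zero => rw [map_zero]; exact Submodule.zero_mem _
  | tmul c t =>
    rw [iota_tmul]
    exact Submodule.smul_mem _ _ (Submodule.subset_span ⟨t, rfl⟩)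
  | add a b ha hb => rw [map_add]; exact Submodule.add_mem _ ha hb

/-- **`ι_T` intertwines the abstract complex conjugation `conj ⊗ id` of `ℂ ⊗_ℚ T` with complex
conjugation of the coordinates of `Λ_ℂ`** (`T` consists of rational, hence real, vectors).
[cite: VoisinHodgeI2002, §7.1.1] -/
theorem iota_conj (z : ℂ ⊗[ℚ] T) : iota T (HodgeStructure.conj z) = star (iota T z) := by
  induction z using TensorProduct.induction_on with
  | zero => rw [map_zero, map_zero, star_zero]
  | tmul c t =>
    rw [HodgeStructure.conj_tmul, iota_tmul, iota_tmul, star_smul, star_ratCastΛ]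
    rfl
  | add a b ha hb => rw [map_add, map_add, map_add, star_add, ha, hb]

/-- **`ι_T` is injective** (`ℂ` is flat over `ℚ`). [cite: VoisinHodgeI2002, §7.1.1] -/
theorem iota_injective : Function.Injective (iota T) := by
  have h1 : Function.Injective (T.subtype.baseChange ℂ) := by
    rw [LinearMap.baseChange_eq_ltensor]
    exact Module.Flat.lTensor_preserves_injective_linearMap _ T.injective_subtype
  intro a b h
  exact h1 ((TensorProduct.piScalarRight ℚ ℂ ℂ K3Index).injective h)

/-- **The base change of the restricted form is the K3 form under `ι_T`**:
`(B|_T)_ℂ(z, z') = (ι_T z . ι_T z')`. [cite: Huybrechts2016K3, Ch. 3 §2.2] -/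
theorem restrict_baseChange_apply (z z' : ℂ ⊗[ℚ] T) :
    (k3FormRat.restrict T).baseChange ℂ z z' = k3Form (iota T z) (iota T z') := by
  induction z using TensorProduct.induction_on with
  | zero => rw [map_zero, LinearMap.zero_apply, map_zero, k3Form_zero_left]
  | tmul c t =>
    induction z' using TensorProduct.induction_on with
    | zero => rw [map_zero, map_zero, k3Form_zero_right]
    | tmul c' t' =>
      rw [LinearMap.BilinForm.baseChange_tmul, iota_tmul, iota_tmul, k3Form_smul_left, k3Form_smul_right,
        k3Form_ratCast, LinearMap.BilinForm.restrict_apply, LinearMap.domRestrict_apply, Rat.smul_def]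
      ring
    | add a b ha hb => rw [map_add, map_add, k3Form_add_right, ha, hb]
  | add a b ha hb => rw [map_add, LinearMap.add_apply, map_add, k3Form_add_left, ha, hb]

/-- A rational scalar acts on `ℂ ⊗_ℚ T` through `ℚ ⊂ ℂ`. [folklore] -/
theorem ratCast_smul_eq (q : ℚ) (z : ℂ ⊗[ℚ] T) : (q : ℂ) • z = q • z := by
  rw [show ((q : ℚ) : ℂ) = algebraMap ℚ ℂ q from (eq_ratCast _ q).symm, algebraMap_smul]

variable {T} {N : Submodule ℚ (K3Index → ℚ)} (hc : IsCompl N T)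

/-- **The retraction `λ_T : Λ_ℂ → ℂ ⊗_ℚ T`** attached to a complement `N` of `T`
(`Λ_ℚ = N ⊕ T`): the `ℂ`-linear map with `λ_T(eⱼ) = 1 ⊗ pr_T(eⱼ)`.
[cite: Huybrechts2016K3, Ch. 3 Lemma 3.3.1] -/
def lam (hc : IsCompl N T) : (K3Index → ℂ) →ₗ[ℂ] ℂ ⊗[ℚ] T :=
  (Pi.basisFun ℂ K3Index).constr ℂ fun j => (1 : ℂ) ⊗ₜ[ℚ] (T.projectionOnto N hc.symm (Pi.single j 1))

/-- `λ_T (ι v) = 1 ⊗ pr_T(v)` for `v ∈ Λ_ℚ`. [folklore] -/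
theorem lam_ratCast (v : K3Index → ℚ) :
    lam hc (fun i => (v i : ℂ)) = (1 : ℂ) ⊗ₜ[ℚ] (T.projectionOnto N hc.symm v) := by
  rw [ratCastΛ_eq_sum, map_sum]
  simp only [map_smul, lam, Module.Basis.constr_basis]
  conv_rhs => rw [eq_sum_single v, map_sum, TensorProduct.tmul_sum]
  refine Finset.sum_congr rfl fun j _ => ?_
  rw [map_smul, TensorProduct.tmul_smul, ratCast_smul_eq]

/-- **`λ_T ∘ ι_T = id`.** [folklore] -/
theorem lam_iota (z : ℂ ⊗[ℚ] T) : lam hc (iota T z) = z := by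
  induction z using TensorProduct.induction_on with
  | zero => rw [map_zero, map_zero]
  | tmul c t =>
    rw [iota_tmul, map_smul, lam_ratCast, Submodule.projectionOnto_apply_left, TensorProduct.smul_tmul',
      smul_eq_mul, mul_one]
  | add a b ha hb => rw [map_add, map_add, ha, hb]

/-- **`ι_T ∘ λ_T` is the complexified projection onto `T` along `N`.** [folklore] -/
theorem iota_lam (z : K3Index → ℂ) : iota T (lam hc z) = cxEnd (T.projection N hc.symm) z := by
  have h : iota T ∘ₗ lam hc = cxEnd (T.projection N hc.symm) :=
    eq_cxEnd_of_forall fun v => by rw [LinearMap.comp_apply, lam_ratCast, iota_one_tmul]; rfl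
  exact LinearMap.congr_fun h z

/-- The complexified projections onto `N` and onto `T` sum to the identity. [folklore] -/
theorem cxEnd_projection_add :
    cxEnd (N.projection T hc) + cxEnd (T.projection N hc.symm) = LinearMap.id := by
  rw [← cxEnd_add, Submodule.projection_add_projection_eq_id, cxEnd_id]

/-- Pointwise form of `cxEnd_projection_add`: `z = pr_{N,ℂ} z + pr_{T,ℂ} z`. [folklore] -/
theorem cxEnd_projection_add_apply (z : K3Index → ℂ) :
    cxEnd (N.projection T hc) z + cxEnd (T.projection N hc.symm) z = z := by
  have h := LinearMap.congr_fun (cxEnd_projection_add hc) z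
  rwa [LinearMap.add_apply] at h

/-- A vector killed by the complexified projection onto `N` is in the image of `ι_T`:
`z = ι_T (λ_T z)`. [folklore] -/
theorem iota_lam_of_proj_eq_zero {z : K3Index → ℂ} (hz : cxEnd (N.projection T hc) z = 0) :
    iota T (lam hc z) = z := by
  rw [iota_lam]
  have h := cxEnd_projection_add_apply hc z
  rwa [hz, zero_add] at h

/-- The image of `ι_T` is killed by the complexified projection onto `N`. [folklore] -/
theorem cxEnd_projection_iota (z : ℂ ⊗[ℚ] T) : cxEnd (N.projection T hc) (iota T z) = 0 := by
  have h := cxEnd_projection_add_apply hc (iota T z)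
  rw [← iota_lam hc, lam_iota hc] at h
  -- `h : P (ι z) + ι z = ι z`
  have h' := congrArg (fun w => w - iota T z) h
  simpa only [add_sub_cancel_right, sub_self] using h'

end Subspace

end Summit.HodgeConjecture.HodgeConjecture.Theorems.AnchorExistenceCMFloor

end
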